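import Summits.AtomisticToContinuum.HydrodynamicLimit.Theses.LambertianContactSwap
import Summits.AtomisticToContinuum.HydrodynamicLimit.Theorems.ImplosionDichotomyHydroLimitInBandEquilibrium
import Literature.Analysis.FluidPDE.PassiveScalarProofs
import HarnessLib

/-!
# `MergingTransfer` (stmt-AtomisticToContinuum-12099): the Markov/Portmanteau transfer

Route `LambertianContactSwap` of the sub-problem `HydrodynamicLimit` decides the conjunct through
`closes hS hL hP hM := hM hP hS hL`; this file proves the typed glue
`MergingTransfer : LocalGibbsProbability → SwapGap → LambertianEuler → HydrodynamicLimit`.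

Mathematics (Billingsley 1999, Thm. 2.1; Dudley 2002, §11.3 — the bounded-Lipschitz /
convergence-in-probability bookkeeping, here between two *sequences* of laws rather than towards a
limit law). Fix profiles and take `σ₀ := min σ_P (min σ_S σ_L)` of the three thresholds. For
`σ < σ₀`, Euler data, flows, the `t = 0` hypothesis, `t < T`, a continuous `χ` and `δ > 0`, put
`c := ∫ χ ρ_t` and `g(x) := min 1 (max (x - δ/2) 0)` (`1`-Lipschitz, values in `[0,1]`,
`g ≥ min 1 (δ/2)` on `{δ < x}`, `g = 0` on `{x ≤ δ/2}`). Then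
`min(1,δ/2) · P_N{δ < |ρ_N(Φ_t z; χ) - c|} ≤ ∫ g|ρ_N(Φ_t z; χ) - c| dP_N` (Markov; the integrand is
bounded and measurable, `P_N` is a probability measure by `LocalGibbsProbability`)
`= ∫ g|ρ_N(Λ_t(z,ξ); χ) - c| d(P_N ⊗ γ^ℕ) + o(1)` (`SwapGap` with the `1`-Lipschitz test function
`F(d,m,e) := g|d - c|`) `≤ (P_N ⊗ γ^ℕ){δ/2 < |ρ_N(Λ_t; χ) - c|} + o(1)` (`g ≤ 𝟙_{(δ/2,∞)}`; this
step is measurability-free: `ENNReal.ofReal (∫ f) ≤ ∫⁻ ofReal f ≤ ν(set)`) `→ 0`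
(`LambertianEuler` at `δ/2`). The same with `‖m - ∫χρu‖` and the energy. The abstract form of
this argument is `tendsto_measure_setOf_lt_of_merging`.
-/

noncomputable section

open MeasureTheory Filter Set Topology
open scoped ENNReal

namespace Summit.AtomisticToContinuum.HydrodynamicLimit.Theorems

open Literature.Analysis.FluidPDE Literature.MathematicalPhysics.KineticTheory
open Summit.AtomisticToContinuum.HydrodynamicLimit.Theses.LambertianContactSwap

/-! ### The cutoff `g_δ(x) = min 1 (max (x - δ/2) 0)` -/

/-- `g_δ ≥ 0`. [folklore] -/
theorem mergingCutoff_nonneg (δ x : ℝ) : 0 ≤ min 1 (max (x - δ / 2) 0) :=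
  le_min zero_le_one (le_max_right _ _)

/-- `g_δ ≤ 1`. [folklore] -/
theorem mergingCutoff_le_one (δ x : ℝ) : min 1 (max (x - δ / 2) 0) ≤ 1 := min_le_left _ _

/-- `|g_δ| ≤ 1`. [folklore] -/
theorem abs_mergingCutoff_le_one (δ x : ℝ) : |min 1 (max (x - δ / 2) 0)| ≤ 1 := by
  rw [abs_of_nonneg (mergingCutoff_nonneg δ x)]
  exact mergingCutoff_le_one δ x

/-- `g_δ = 0` on `{x ≤ δ/2}`. [folklore] -/
theorem mergingCutoff_eq_zero {δ x : ℝ} (h : x ≤ δ / 2) : min 1 (max (x - δ / 2) 0) = 0 := by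
  rw [max_eq_right (sub_nonpos.2 h), min_eq_right zero_le_one]

/-- `g_δ ≥ min 1 (δ/2)` on `{δ < x}`. [folklore] -/
theorem min_le_mergingCutoff {δ x : ℝ} (h : δ < x) :
    min 1 (δ / 2) ≤ min 1 (max (x - δ / 2) 0) := by
  refine le_min (min_le_left _ _) ((min_le_right _ _).trans (le_max_of_le_left ?_))
  linarith

/-- `g_δ` is `1`-Lipschitz. [folklore] -/
theorem lipschitzWith_mergingCutoff (δ : ℝ) :
    LipschitzWith 1 fun x : ℝ => min 1 (max (x - δ / 2) 0) := by
  refine LipschitzWith.mk_one fun x y => ?_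
  rw [Real.dist_eq, Real.dist_eq]
  calc |min 1 (max (x - δ / 2) 0) - min 1 (max (y - δ / 2) 0)|
      ≤ max |(1 : ℝ) - 1| |max (x - δ / 2) 0 - max (y - δ / 2) 0| :=
        abs_min_sub_min_le_max _ _ _ _
    _ = |max (x - δ / 2) 0 - max (y - δ / 2) 0| := by
        rw [sub_self, abs_zero, max_eq_right (abs_nonneg _)]
    _ ≤ |x - δ / 2 - (y - δ / 2)| := abs_max_sub_max_le_abs _ _ _
    _ = |x - y| := by rw [sub_sub_sub_cancel_right]

/-- The cutoff packaged: a `1`-Lipschitz `g : ℝ → [0, 1]` vanishing on `(-∞, δ/2]` and at least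
`min 1 (δ/2)` on `(δ, ∞)`. [folklore] -/
theorem exists_mergingCutoff (δ : ℝ) :
    ∃ g : ℝ → ℝ, LipschitzWith 1 g ∧ (∀ x, |g x| ≤ 1) ∧ (∀ x, 0 ≤ g x) ∧ (∀ x, g x ≤ 1) ∧
      (∀ x, x ≤ δ / 2 → g x = 0) ∧ (∀ x, δ < x → min 1 (δ / 2) ≤ g x) :=
  ⟨fun x => min 1 (max (x - δ / 2) 0), lipschitzWith_mergingCutoff δ, abs_mergingCutoff_le_one δ,
    mergingCutoff_nonneg δ, mergingCutoff_le_one δ, fun _ => mergingCutoff_eq_zero,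
    fun _ => min_le_mergingCutoff⟩

/-! ### The abstract transfer lemma -/

/-- **Abstract merging transfer (Markov + bounded-Lipschitz merging + convergence in
probability).** Let `μₙ`, `νₙ` be finite measures, `Xₙ` measurable real functions and `Yₙ`
arbitrary real functions. If `∫ g∘Xₙ dμₙ - ∫ g∘Yₙ dνₙ → 0` for every `1`-Lipschitz `g` with
`|g| ≤ 1`, and `νₙ{δ < Yₙ} → 0` for every `δ > 0`, then `μₙ{δ < Xₙ} → 0` for every `δ > 0`
(Billingsley 1999 Thm. 2.1 / Dudley 2002 §11.3 bookkeeping, run between two sequences).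
[cite: Dudley2002, §11.3] -/
theorem tendsto_measure_setOf_lt_of_merging {α β : ℕ → Type*} [∀ n, MeasurableSpace (α n)]
    [∀ n, MeasurableSpace (β n)] (μ : ∀ n, Measure (α n)) (ν : ∀ n, Measure (β n))
    (hμ : ∀ n, IsFiniteMeasure (μ n))
    (X : ∀ n, α n → ℝ) (Y : ∀ n, β n → ℝ) (hX : ∀ n, Measurable (X n))
    (hswap : ∀ g : ℝ → ℝ, LipschitzWith 1 g → (∀ y, |g y| ≤ 1) →
      Tendsto (fun n => (∫ z, g (X n z) ∂μ n) - ∫ p, g (Y n p) ∂ν n) atTop (𝓝 0))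
    (hY : ∀ δ : ℝ, 0 < δ → Tendsto (fun n => ν n {p | δ < Y n p}) atTop (𝓝 0))
    {δ : ℝ} (hδ : 0 < δ) :
    Tendsto (fun n => μ n {z | δ < X n z}) atTop (𝓝 0) := by
  obtain ⟨g, hg_lip, hg_abs, hg_nonneg, hg_le_one, hg_zero, hg_ge⟩ := exists_mergingCutoff δ
  have hκpos : 0 < min 1 (δ / 2) := lt_min one_pos (half_pos hδ)
  have hb_nonneg : ∀ n, 0 ≤ ∫ p, g (Y n p) ∂ν n :=
    fun n => integral_nonneg fun p => hg_nonneg _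
  -- (1) the `ν`-side bound, measurability-free
  have hb_le : ∀ n, ENNReal.ofReal (∫ p, g (Y n p) ∂ν n) ≤ ν n {p | δ / 2 < Y n p} := by
    intro n
    refine (Literature.Analysis.FluidPDE.ofReal_integral_le_lintegral_ofReal _).trans ?_
    refine (lintegral_mono fun p => ?_).trans (lintegral_indicator_one_le _)
    by_cases hp : δ / 2 < Y n p
    · have hp' : p ∈ {p | δ / 2 < Y n p} := hp
      rw [Set.indicator_of_mem hp', Pi.one_apply]
      exact ENNReal.ofReal_le_one.2 (hg_le_one _)
    · have hp' : p ∉ {p | δ / 2 < Y n p} := hp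
      rw [Set.indicator_of_notMem hp', hg_zero _ (not_lt.1 hp), ENNReal.ofReal_zero]
  -- (2) `∫ g∘Yₙ dνₙ → 0`
  have hb : Tendsto (fun n => ∫ p, g (Y n p) ∂ν n) atTop (𝓝 0) := by
    have h1 : Tendsto (fun n => ENNReal.ofReal (∫ p, g (Y n p) ∂ν n)) atTop (𝓝 0) :=
      tendsto_of_tendsto_of_tendsto_of_le_of_le tendsto_const_nhds (hY _ (half_pos hδ))
        (fun n => zero_le) hb_le
    have h2 := (ENNReal.tendsto_toReal_zero_iff (fun n => ENNReal.ofReal_ne_top)).2 h1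
    refine h2.congr fun n => ?_
    exact ENNReal.toReal_ofReal (hb_nonneg n)
  -- (3) `∫ g∘Xₙ dμₙ → 0`
  have ha : Tendsto (fun n => ∫ z, g (X n z) ∂μ n) atTop (𝓝 0) := by
    have := (hswap g hg_lip hg_abs).add hb
    simpa using this
  -- (4) Markov: `min 1 (δ/2) · μₙ{δ < Xₙ} ≤ ∫ g∘Xₙ dμₙ`
  have hA : ∀ n, MeasurableSet {z | δ < X n z} :=
    fun n => measurableSet_lt measurable_const (hX n)
  have ha_ge : ∀ n, min 1 (δ / 2) * (μ n {z | δ < X n z}).toReal ≤ ∫ z, g (X n z) ∂μ n := by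
    intro n
    haveI := hμ n
    have hint : Integrable (fun z => g (X n z)) (μ n) :=
      Integrable.of_bound (hg_lip.continuous.measurable.comp (hX n)).aestronglyMeasurable 1
        (Eventually.of_forall fun z => by
          rw [Real.norm_eq_abs]
          exact hg_abs (X n z))
    calc min 1 (δ / 2) * (μ n {z | δ < X n z}).toReal
        = ∫ z, {z | δ < X n z}.indicator (fun _ => min 1 (δ / 2)) z ∂μ n := by
          rw [integral_indicator_const _ (hA n), smul_eq_mul, measureReal_def, mul_comm]
      _ ≤ ∫ z, g (X n z) ∂μ n := by
          refine integral_mono ((integrable_const _).indicator (hA n)) hint fun z => ?_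
          by_cases hz : δ < X n z
          · have hz' : z ∈ {z | δ < X n z} := hz
            rw [Set.indicator_of_mem hz']
            exact hg_ge _ hz
          · have hz' : z ∉ {z | δ < X n z} := hz
            rw [Set.indicator_of_notMem hz']
            exact hg_nonneg _
  -- (5) squeeze
  have hfin : ∀ n, μ n {z | δ < X n z} ≠ ∞ := fun n => by
    haveI := hμ n
    exact measure_ne_top _ _
  refine (ENNReal.tendsto_toReal_zero_iff hfin).1 ?_
  have h0 : Tendsto (fun n => (min 1 (δ / 2))⁻¹ * ∫ z, g (X n z) ∂μ n) atTop (𝓝 0) := by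
    simpa using ha.const_mul (min 1 (δ / 2))⁻¹
  refine tendsto_of_tendsto_of_tendsto_of_le_of_le tendsto_const_nhds h0
    (fun n => ENNReal.toReal_nonneg) fun n => ?_
  rw [le_inv_mul_iff₀ hκpos]
  exact ha_ge n

/-! ### Lipschitz test functions -/

/-- A `1`-Lipschitz map does not increase distances. [folklore] -/
theorem dist_le_of_lipschitzWith_one {α β : Type*} [PseudoMetricSpace α] [PseudoMetricSpace β]
    {f : α → β} (hf : LipschitzWith 1 f) (x y : α) : dist (f x) (f y) ≤ dist x y := by
  simpa using hf.dist_le_mul x y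

/-- `x ↦ |x - c|` is `1`-Lipschitz on `ℝ`. [folklore] -/
theorem lipschitzWith_abs_sub_const (c : ℝ) : LipschitzWith 1 fun x : ℝ => |x - c| := by
  simpa only [Real.dist_eq] using LipschitzWith.dist_left c

/-- `m ↦ ‖m - c‖` is `1`-Lipschitz on a seminormed group. [folklore] -/
theorem lipschitzWith_norm_sub_const {E : Type*} [SeminormedAddCommGroup E] (c : E) :
    LipschitzWith 1 fun x : E => ‖x - c‖ := by
  simpa only [dist_eq_norm] using LipschitzWith.dist_left c

/-- The density test function `(d, m, e) ↦ g |d - c|` is `1`-Lipschitz for `1`-Lipschitz `g`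
(sup metric on the product). [folklore] -/
theorem lipschitzWith_densityTest {g : ℝ → ℝ} (hg : LipschitzWith 1 g) (c : ℝ) :
    LipschitzWith 1 fun y : ℝ × V3 × ℝ => g |y.1 - c| := by
  refine LipschitzWith.mk_one fun y y' => ?_
  calc dist (g |y.1 - c|) (g |y'.1 - c|) ≤ dist |y.1 - c| |y'.1 - c| :=
        dist_le_of_lipschitzWith_one hg _ _
    _ ≤ dist y.1 y'.1 := dist_le_of_lipschitzWith_one (lipschitzWith_abs_sub_const c) _ _
    _ ≤ dist y y' := dist_le_of_lipschitzWith_one LipschitzWith.prod_fst y y'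

/-- The momentum test function `(d, m, e) ↦ g ‖m - c‖` is `1`-Lipschitz for `1`-Lipschitz `g`.
[folklore] -/
theorem lipschitzWith_momentumTest {g : ℝ → ℝ} (hg : LipschitzWith 1 g) (c : V3) :
    LipschitzWith 1 fun y : ℝ × V3 × ℝ => g ‖y.2.1 - c‖ := by
  refine LipschitzWith.mk_one fun y y' => ?_
  calc dist (g ‖y.2.1 - c‖) (g ‖y'.2.1 - c‖) ≤ dist ‖y.2.1 - c‖ ‖y'.2.1 - c‖ :=
        dist_le_of_lipschitzWith_one hg _ _
    _ ≤ dist y.2.1 y'.2.1 := dist_le_of_lipschitzWith_one (lipschitzWith_norm_sub_const c) _ _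
    _ ≤ dist y.2 y'.2 := dist_le_of_lipschitzWith_one LipschitzWith.prod_fst y.2 y'.2
    _ ≤ dist y y' := dist_le_of_lipschitzWith_one LipschitzWith.prod_snd y y'

/-- The energy test function `(d, m, e) ↦ g |e - c|` is `1`-Lipschitz for `1`-Lipschitz `g`.
[folklore] -/
theorem lipschitzWith_energyTest {g : ℝ → ℝ} (hg : LipschitzWith 1 g) (c : ℝ) :
    LipschitzWith 1 fun y : ℝ × V3 × ℝ => g |y.2.2 - c| := by
  refine LipschitzWith.mk_one fun y y' => ?_
  calc dist (g |y.2.2 - c|) (g |y'.2.2 - c|) ≤ dist |y.2.2 - c| |y'.2.2 - c| :=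
        dist_le_of_lipschitzWith_one hg _ _
    _ ≤ dist y.2.2 y'.2.2 := dist_le_of_lipschitzWith_one (lipschitzWith_abs_sub_const c) _ _
    _ ≤ dist y.2 y'.2 := dist_le_of_lipschitzWith_one LipschitzWith.prod_snd y.2 y'.2
    _ ≤ dist y y' := dist_le_of_lipschitzWith_one LipschitzWith.prod_snd y y'

/-! ### The item -/

/-- **`MergingTransfer` (stmt-AtomisticToContinuum-12099).** If the local Gibbs laws are
probability measures for small `σ` (`LocalGibbsProbability`), the `χ`-tested field laws of the
deterministic flow `Φ_t` and of the Lambertian flow `Λ_t` merge in bounded-Lipschitz distance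
(`SwapGap`) and `Λ`'s fields converge in probability to the Euler values (`LambertianEuler`),
then the sub-problem statement `HydrodynamicLimit` holds: with `σ₀ := min σ_P (min σ_S σ_L)`,
each of the three deviation probabilities is transferred by
`tendsto_measure_setOf_lt_of_merging` (Markov with the cutoff `g_δ`, the merging hypothesis for
the `1`-Lipschitz test function `g_δ ∘ |· - c| ∘ proj`, and `LambertianEuler`).
[cite: Dudley2002, §11.3] -/
theorem mergingTransfer_proof :
    Summit.AtomisticToContinuum.HydrodynamicLimit.Theses.LambertianContactSwap.MergingTransfer := by
  unfold MergingTransfer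
  intro hP hS hL a₀ θ₀ u₀ ha hθ hu ha0 hθ0
  obtain ⟨σP, hσP, hP'⟩ := hP
  obtain ⟨σS, hσS, hS'⟩ := hS a₀ θ₀ u₀ ha hθ hu ha0 hθ0
  obtain ⟨σL, hσL, hL'⟩ := hL a₀ θ₀ u₀ ha hθ hu ha0 hθ0
  refine ⟨min σP (min σS σL), lt_min hσP (lt_min hσS hσL), ?_⟩
  intro σ hσ hσlt T ρ θ u hE Φ h0 t ht χ hχ δ hδ
  have hσP' : σ < σP := hσlt.trans_le (min_le_left _ _)
  have hσS' : σ < σS := hσlt.trans_le ((min_le_right _ _).trans (min_le_left _ _))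
  have hσL' : σ < σL := hσlt.trans_le ((min_le_right _ _).trans (min_le_right _ _))
  have hPN : ∀ N, IsProbabilityMeasure (localGibbsLaw σ a₀ u₀ θ₀ N (Φ N)) :=
    fun N => hP' σ hσ hσP' a₀ θ₀ u₀ ha hθ hu ha0 hθ0 N (Φ N)
  have hSw := hS' σ hσ hσS' T ρ θ u hE Φ h0 t ht χ hχ
  have hLa := hL' σ hσ hσL' T ρ θ u hE Φ h0 t ht χ hχ
  have hμ : ∀ N, IsFiniteMeasure (localGibbsLaw σ a₀ u₀ θ₀ N (Φ N)) := fun N => by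
    haveI := hPN N
    infer_instance
  -- the three Euler values at time `t`
  set cD : ℝ := ∫ x, χ x * ρ t x with hcD
  set cM : V3 := ∫ x, (χ x * ρ t x) • u t x with hcM
  set cE : ℝ := ∫ x, χ x * totalEnergyDensity (ρ t x) (u t x) (θ t x) with hcE
  -- measurability of the deterministic deviations
  have hXD : ∀ N, Measurable fun z : Config (N + 1) (Fin 3) T3 =>
      |empiricalDensityField ((Φ N).flow t z) χ - cD| := fun N =>
    (((measurable_empiricalDensityField hχ).comp ((Φ N).measurable_flow t)).sub
      measurable_const).abs
  have hXM : ∀ N, Measurable fun z : Config (N + 1) (Fin 3) T3 =>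
      ‖empiricalMomentumField ((Φ N).flow t z) χ - cM‖ := fun N =>
    (((measurable_empiricalMomentumField hχ).comp ((Φ N).measurable_flow t)).sub
      measurable_const).norm
  have hXE : ∀ N, Measurable fun z : Config (N + 1) (Fin 3) T3 =>
      |empiricalEnergyField ((Φ N).flow t z) χ - cE| := fun N =>
    (((measurable_empiricalEnergyField hχ).comp ((Φ N).measurable_flow t)).sub
      measurable_const).abs
  refine ⟨?_, ?_, ?_⟩
  · refine tendsto_measure_setOf_lt_of_merging (fun N => localGibbsLaw σ a₀ u₀ θ₀ N (Φ N))
      (fun N => (localGibbsLaw σ a₀ u₀ θ₀ N (Φ N)).prod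
        (Measure.infinitePi fun _ : ℕ => ProbabilityTheory.stdGaussian V3))
      hμ (fun N z => |empiricalDensityField ((Φ N).flow t z) χ - cD|) _ hXD
      (fun g hg hg1 => hSw (fun y => g |y.1 - cD|) (lipschitzWith_densityTest hg cD)
        (fun y => hg1 _))
      (fun δ' hδ' => (hLa δ' hδ').1) hδ
  · refine tendsto_measure_setOf_lt_of_merging (fun N => localGibbsLaw σ a₀ u₀ θ₀ N (Φ N))
      (fun N => (localGibbsLaw σ a₀ u₀ θ₀ N (Φ N)).prod
        (Measure.infinitePi fun _ : ℕ => ProbabilityTheory.stdGaussian V3))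
      hμ (fun N z => ‖empiricalMomentumField ((Φ N).flow t z) χ - cM‖) _ hXM
      (fun g hg hg1 => hSw (fun y => g ‖y.2.1 - cM‖) (lipschitzWith_momentumTest hg cM)
        (fun y => hg1 _))
      (fun δ' hδ' => (hLa δ' hδ').2.1) hδ
  · refine tendsto_measure_setOf_lt_of_merging (fun N => localGibbsLaw σ a₀ u₀ θ₀ N (Φ N))
      (fun N => (localGibbsLaw σ a₀ u₀ θ₀ N (Φ N)).prod
        (Measure.infinitePi fun _ : ℕ => ProbabilityTheory.stdGaussian V3))
      hμ (fun N z => |empiricalEnergyField ((Φ N).flow t z) χ - cE|) _ hXE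
      (fun g hg hg1 => hSw (fun y => g |y.2.2 - cE|) (lipschitzWith_energyTest hg cE)
        (fun y => hg1 _))
      (fun δ' hδ' => (hLa δ' hδ').2.2) hδ

end Summit.AtomisticToContinuum.HydrodynamicLimit.Theorems
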